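import Summits.AtomisticToContinuum.Crystallization.Theorems.ExcessDecayLiouvilleStepRows
import Summits.AtomisticToContinuum.Crystallization.Theorems.ExcessDecayLiouvilleStepCompare
import Summits.AtomisticToContinuum.Crystallization.Theorems.ExcessDecayLiouvilleLevelMasses

/-!
# Route `ExcessDecayLiouville`: the harmonic replacement at one scale, assembled (nonlinear half, XIX)

Harmonic-replacement architecture for item `ExcessDecay` (stmt-AtomisticToContinuum-9334), nonlinear half.
At a centre `c₀ ∈ B_{r/8}(c)` and a radius `ρ'` (with `dist c₀ c + ρ' + 10L + 20 ≤ r/2`), for a RELAXED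
affine-plus-shift approximant `aff` (data `a, B`, base `c₀`, `‖a 0 − a 1‖ ≤ 1/100`, `2r‖B‖ ≤ 1/100`) and the
cut-off displacement `v = χ·ũ`, `ũ = (π x − x) − aff x` (`‖ũ‖ ≤ D ≤ 1/20` on `SR`): the rows package
(`step_rows`, `step_flux`, `step_forcing`) feeds `step_compare`, and the forcing sum over the sites `F` of
`B_{ρ'}(c₀)` is at most `32ρ'³ Φ₀²` (`step_harmonic`).  Output: the correction `w` with `L(v + w) = 0` on `F`,
its Poincaré bound and its energy bound in the currencies `E₁, E₂, J₂` (sums of `‖ũ‖²` over `SR`) and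
`NN[v, c₀, ρ' + 10L + 20]`.
All `[folklore]`; helper lemmas, nothing here closes an item.
-/

noncomputable section

namespace Summit.AtomisticToContinuum.Crystallization.Theorems.ExcessDecayLiouville

open scoped BigOperators Topology InnerProductSpace RealInnerProductSpace Classical
open Literature.MathematicalPhysics.StatisticalMechanics
open Summit.AtomisticToContinuum.Crystallization.Theorems.PhononStabilityNegative

-- Local notation: the force-constant map `K(e)w = h(|e|²)w + 2⟪e,w⟫h′(|e|²)e`.
local notation3 "𝕂[" e "] " w:max =>
  (-((‖e‖ ^ 2)⁻¹) ^ 7 + ((‖e‖ ^ 2)⁻¹) ^ 4) • w + (2 * ⟪e, w⟫ * (7 * ((‖e‖ ^ 2)⁻¹) ^ 8 - 4 * ((‖e‖ ^ 2)⁻¹) ^ 5)) • e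
-- Local notation: the pair force `F(x) = h(|x|²) x`.
local notation3 "𝐅[" x "]" => ((-((‖x‖ ^ 2)⁻¹) ^ 7 + ((‖x‖ ^ 2)⁻¹) ^ 4) • x)

section

variable {X : Set (EuclideanSpace ℝ (Fin 3))} {c : EuclideanSpace ℝ (Fin 3)} {r ε δ κ : ℝ}
  {t : Fin 2 → EuclideanSpace ℝ (Fin 3)} {A : EuclideanSpace ℝ (Fin 3) →L[ℝ] EuclideanSpace ℝ (Fin 3)}
  {π : EuclideanSpace ℝ (Fin 3) → EuclideanSpace ℝ (Fin 3)}
  {aff : (EuclideanSpace ℝ (Fin 3)) → (EuclideanSpace ℝ (Fin 3))} {a : Fin 2 → EuclideanSpace ℝ (Fin 3)}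
  {B : (EuclideanSpace ℝ (Fin 3)) →L[ℝ] (EuclideanSpace ℝ (Fin 3))} {c₀ : EuclideanSpace ℝ (Fin 3)}

variable (hA : Adm₀ A) (hI : Inner₀ t A)

set_option quotPrecheck false in
-- Local notation: the operator row `(L v)(p)`.
local notation "𝕃" v:max " @ " p:max =>
  tsum (fun q : Sites₀ t A => (if ((p : Sites₀ t A) : EuclideanSpace ℝ (Fin 3)) ≠ q then
    𝕂[((p : Sites₀ t A) : EuclideanSpace ℝ (Fin 3)) - q] (v ((p : Sites₀ t A) : EuclideanSpace ℝ (Fin 3)) - v q) else 0))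
set_option quotPrecheck false in
-- Local notation: the finite near-neighbour form on the ball of radius `X` about `c₀`.
local notation "NN[" v ", " X "]" =>
  (∑ p ∈ (finite_sites_dist_le (t := t) (A := A) hA hI c₀ X).toFinset,
    ∑ q ∈ (finite_sites_dist_le (t := t) (A := A) hA hI c₀ X).toFinset,
      (if p ≠ q ∧ dist p q ≤ 11 / 10 then ‖v p - v q‖ ^ 2 else (0 : ℝ)))

include hA hI in
/-- **The harmonic replacement at one scale** (see the module docstring). [folklore] -/
theorem step_harmonic (hκ0 : 0 < κ)
    (hκ : ∀ v : (EuclideanSpace ℝ (Fin 3)) → (EuclideanSpace ℝ (Fin 3)), (Function.support v).Finite →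
      Function.support v ⊆ Sites₀ t A → κ * nnForm t A v ≤ ∑' p : Sites₀ t A, ⟪𝕃 v @ p, v p⟫)
    (hX : X.Finite) (hsep : Sep₀ X δ) (hequil : Equil₀ X) (hδ : 0 < δ) (hδ1 : δ ≤ 1)
    (hε0 : 0 ≤ ε) (hε : 2 * ε < δ) (hr : 8 ≤ r)
    (hXb : ∀ p ∈ X, dist p c ≤ r → ∃ m : Fin 2, ∃ z ∈ Λ₀, dist p (t m + A z) ≤ ε)
    (hπ : ∀ s' ∈ Sites₀ t A, dist s' c ≤ r → π s' ∈ X ∧ dist (π s') s' ≤ ε)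
    (hinj : ∀ s₁ ∈ Sites₀ t A, ∀ s₂ ∈ Sites₀ t A, dist s₁ c ≤ r → dist s₂ c ≤ r → π s₁ = π s₂ → s₁ = s₂)
    (SR : Finset (EuclideanSpace ℝ (Fin 3))) (hSR : ∀ x, x ∈ SR ↔ x ∈ Sites₀ t A ∧ dist x c ≤ r)
    (χ : EuclideanSpace ℝ (Fin 3) → ℝ) (hχ0 : ∀ q ∈ Sites₀ t A, q ∉ SR → χ q = 0)
    (hχ1abs : ∀ x, |1 - χ x| ≤ 1) (hχone : ∀ q ∈ SR, dist q c ≤ r / 2 → χ q = 1)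
    (haff : ∀ (m : Fin 2) (z : EuclideanSpace ℝ (Fin 3)), z ∈ Λ₀ → aff (t m + A z) = a m + B (t m + A z - c₀))
    (hrelax : ∀ s : Sites₀ t A, (∑' q : Sites₀ t A, (if (s : EuclideanSpace ℝ (Fin 3)) ≠ q then
        𝐅[((s : EuclideanSpace ℝ (Fin 3)) - q) + (aff s - aff q)] else 0)) = 0)
    (ha : ‖a 0 - a 1‖ ≤ 1 / 100) (hBr : 2 * r * ‖B‖ ≤ 1 / 100)
    {D : ℝ} (hD : 0 ≤ D) (hD' : D ≤ 1 / 20) (hDb : ∀ x ∈ SR, ‖(π x - x) - aff x‖ ≤ D)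
    (hv : (Function.support (fun x => χ x • ((π x - x) - aff x))).Finite)
    {ρ' L : ℝ} (hρ' : 1 ≤ ρ') (hL : 1 ≤ L) (hgeom : dist c₀ c + (ρ' + 10 * L + 20) ≤ r / 2)
    (hgeom' : dist c₀ c + ρ' ≤ r / 4) :
    ∃ w : (EuclideanSpace ℝ (Fin 3)) → (EuclideanSpace ℝ (Fin 3)),
      Function.support w ⊆ (finite_sites_dist_le (t := t) (A := A) hA hI c₀ ρ').toFinset ∧
      (Function.support w).Finite ∧
      (∀ p : Sites₀ t A, dist (p : EuclideanSpace ℝ (Fin 3)) c₀ ≤ ρ' →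
        𝕃 (fun x => (χ x • ((π x - x) - aff x)) + w x) @ p = 0) ∧
      ∑' p : Sites₀ t A, ‖w p‖ ^ 2 ≤ (400 * ρ' / 189 + 2) ^ 2 * nnForm t A w ∧
      nnForm t A w ≤ 2 * (((Real.sqrt (32 * ρ' ^ 3) *
          (31488 * (1024 / ((23 / 25 : ℝ) ^ 3 * (r / 2) ^ 4)) + 2048 / (δ ^ 3 * (r / 4) ^ 4) +
            (38 * D * (1024 / ((23 / 25 : ℝ) ^ 3 * (r / 4) ^ 5)) + 38 * D * (1024 / ((23 / 25 : ℝ) ^ 3 * (r / 2) ^ 5)))) +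
        (210000 * ((25 / 23) * (2 * D + ‖a 0 - a 1‖) + ‖B‖)) * (3 * (1024 / ((23 / 25 : ℝ) ^ 3 * L ^ 5)) *
            Real.sqrt (∑ x ∈ SR.filter (fun p => dist p c₀ ≤ ρ'), ‖(π x - x) - aff x‖ ^ 2) +
          Real.sqrt (1024 / ((23 / 25 : ℝ) ^ 3 * L ^ 5)) * Real.sqrt
            ((1024 / ((23 / 25 : ℝ) ^ 3 * L ^ 5)) * (∑ q ∈ SR.filter (fun q => dist q c₀ ≤ 2 * ρ'), ‖(π q - q) - aff q‖ ^ 2) +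
              8192 * ρ' ^ 3 * ∑ q ∈ SR.filter (fun q => ¬ dist q c₀ ≤ 2 * ρ'), (dist q c₀)⁻¹ ^ 8 * ‖(π q - q) - aff q‖ ^ 2))) *
          (400 * ρ' / 189 + 2)) ^ 2 +
        (4000000 * (210000 * ((25 / 23) * (2 * D + ‖a 0 - a 1‖) + ‖B‖)) *
          Real.sqrt (NN[(fun x => χ x • ((π x - x) - aff x)), ρ' + 10 * L + 20])) ^ 2) / κ ^ 2 := by
  have hSRS : ∀ x ∈ SR, x ∈ Sites₀ t A := fun x hx => ((hSR x).1 hx).1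
  have hL0 : 0 ≤ 10 * L + 20 := by linarith
  have hball : ∀ x : EuclideanSpace ℝ (Fin 3), dist x c₀ ≤ ρ' + 10 * L + 20 → dist x c ≤ r / 2 := by
    intro x hx
    have := dist_triangle x c₀ c
    linarith
  have hSRball : ∀ x ∈ Sites₀ t A, dist x c₀ ≤ ρ' + 10 * L + 20 → x ∈ SR := fun x hx hxd =>
    (hSR x).2 ⟨hx, by linarith [hball x hxd]⟩
  -- rows, flux
  have hrows := step_rows hA hI hX hequil hπ hinj SR hSR χ hχ0 hv (aff := aff)
  have hBn : 0 ≤ ‖B‖ := norm_nonneg _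
  have hB50 : ‖B‖ ≤ 1 / 50 := by nlinarith
  have hsmall : ‖a 0 - a 1‖ + 2 * r * ‖B‖ ≤ 1 / 50 := by linarith
  obtain ⟨hanti, hΦ⟩ := step_flux hA hI haff SR hSR (D₀ := 2 * D) (by linarith) (by linarith) hsmall
    (fun x hx => by linarith [hDb x hx]) (π := π)
  have hrow' : ∀ p : Sites₀ t A, (p : EuclideanSpace ℝ (Fin 3)) ∈ SR →
      dist (p : EuclideanSpace ℝ (Fin 3)) c₀ ≤ ρ' + 10 * L + 20 →
      𝕃 (fun x => χ x • ((π x - x) - aff x)) @ p = _ := fun p hp hpd => hrows p hp (hχone p hp (hball p hpd))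
  have hvt : ∀ x ∈ Sites₀ t A, dist x c₀ ≤ ρ' + 10 * L + 20 →
      (fun x => (π x - x) - aff x) x = (fun x => χ x • ((π x - x) - aff x)) x := by
    intro x hx hxd
    simp only []
    rw [hχone x (hSRball x hx hxd) (hball x hxd), one_smul]
  have hΛ0 : 0 ≤ 210000 * ((25 / 23) * (2 * D + ‖a 0 - a 1‖) + ‖B‖) := by positivity
  -- the comparison
  obtain ⟨w, hwF, hwfin, hw0, hE, hP⟩ := step_compare hA hI hκ0 hκ SR hSRS hρ' hL hSRball
    (fun x => χ x • ((π x - x) - aff x)) (fun x => (π x - x) - aff x) hv hvt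
    (fun s : EuclideanSpace ℝ (Fin 3) =>
      (-(∑ s' ∈ SR.erase s, 𝐅[(s - s') + (aff s - aff s')]) -
        (∑ q ∈ (hX.toFinset.erase (π s)) \ ((SR.erase s).image π),
          (deriv lennardJones (dist (π s) q) / dist (π s) q) • (π s - q)) +
        ((∑ s' ∈ SR.erase s, 𝕂[s - s'] ((1 - χ s') • ((π s' - s') - aff s'))) +
          ∑' q : ↑((SR.subtype (· ∈ Sites₀ t A) : Set (Sites₀ t A)))ᶜ,
            (if s ≠ (q : EuclideanSpace ℝ (Fin 3)) then 𝕂[s - (q : EuclideanSpace ℝ (Fin 3))] ((π s - s) - aff s) else 0))))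
    (fun s q : EuclideanSpace ℝ (Fin 3) =>
      (-((𝐅[(s - q) + ((aff s - aff q) + (((π s - s) - aff s) - ((π q - q) - aff q)))] - 𝐅[s - q] -
          𝕂[s - q] ((aff s - aff q) + (((π s - s) - aff s) - ((π q - q) - aff q)))) -
        (𝐅[(s - q) + (aff s - aff q)] - 𝐅[s - q] - 𝕂[s - q] (aff s - aff q)))))
    hrow' hanti hΛ0 hΦ (c₀ := c₀)
  refine ⟨w, hwF, hwfin, hw0, hP, hE.trans ?_⟩
  -- the forcing sum over F
  have hforce := step_forcing hA hI hX hsep hδ hδ1 hε0 hε hr hXb hπ haff (by linarith) hB50 hrelax SR hSR χ hχ1abs hχone hD hDb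
  have hΦ₀ : 0 ≤ 31488 * (1024 / ((23 / 25 : ℝ) ^ 3 * (r / 2) ^ 4)) + 2048 / (δ ^ 3 * (r / 4) ^ 4) +
      (38 * D * (1024 / ((23 / 25 : ℝ) ^ 3 * (r / 4) ^ 5)) + 38 * D * (1024 / ((23 / 25 : ℝ) ^ 3 * (r / 2) ^ 5))) := by
    have hr0 : 0 < r := by linarith
    positivity
  have hmemF : ∀ x ∈ (finite_sites_dist_le (t := t) (A := A) hA hI c₀ ρ').toFinset, x ∈ Sites₀ t A ∧ dist x c₀ ≤ ρ' :=
    fun x hx => by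
      have h := (Set.Finite.mem_toFinset (finite_sites_dist_le (t := t) (A := A) hA hI c₀ ρ')).1 hx
      exact h
  have hsumφ : ∑ x ∈ (finite_sites_dist_le (t := t) (A := A) hA hI c₀ ρ').toFinset,
      ‖(fun s : EuclideanSpace ℝ (Fin 3) =>
        (-(∑ s' ∈ SR.erase s, 𝐅[(s - s') + (aff s - aff s')]) -
          (∑ q ∈ (hX.toFinset.erase (π s)) \ ((SR.erase s).image π),
            (deriv lennardJones (dist (π s) q) / dist (π s) q) • (π s - q)) +
          ((∑ s' ∈ SR.erase s, 𝕂[s - s'] ((1 - χ s') • ((π s' - s') - aff s'))) +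
            ∑' q : ↑((SR.subtype (· ∈ Sites₀ t A) : Set (Sites₀ t A)))ᶜ,
              (if s ≠ (q : EuclideanSpace ℝ (Fin 3)) then 𝕂[s - (q : EuclideanSpace ℝ (Fin 3))] ((π s - s) - aff s) else 0)))) x‖ ^ 2 ≤
      32 * ρ' ^ 3 * (31488 * (1024 / ((23 / 25 : ℝ) ^ 3 * (r / 2) ^ 4)) + 2048 / (δ ^ 3 * (r / 4) ^ 4) +
        (38 * D * (1024 / ((23 / 25 : ℝ) ^ 3 * (r / 4) ^ 5)) + 38 * D * (1024 / ((23 / 25 : ℝ) ^ 3 * (r / 2) ^ 5)))) ^ 2 := by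
    have hpt : ∀ x ∈ (finite_sites_dist_le (t := t) (A := A) hA hI c₀ ρ').toFinset,
        ‖(fun s : EuclideanSpace ℝ (Fin 3) =>
          (-(∑ s' ∈ SR.erase s, 𝐅[(s - s') + (aff s - aff s')]) -
            (∑ q ∈ (hX.toFinset.erase (π s)) \ ((SR.erase s).image π),
              (deriv lennardJones (dist (π s) q) / dist (π s) q) • (π s - q)) +
            ((∑ s' ∈ SR.erase s, 𝕂[s - s'] ((1 - χ s') • ((π s' - s') - aff s'))) +
              ∑' q : ↑((SR.subtype (· ∈ Sites₀ t A) : Set (Sites₀ t A)))ᶜ,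
                (if s ≠ (q : EuclideanSpace ℝ (Fin 3)) then 𝕂[s - (q : EuclideanSpace ℝ (Fin 3))] ((π s - s) - aff s) else 0)))) x‖ ^ 2 ≤
        (31488 * (1024 / ((23 / 25 : ℝ) ^ 3 * (r / 2) ^ 4)) + 2048 / (δ ^ 3 * (r / 4) ^ 4) +
          (38 * D * (1024 / ((23 / 25 : ℝ) ^ 3 * (r / 4) ^ 5)) + 38 * D * (1024 / ((23 / 25 : ℝ) ^ 3 * (r / 2) ^ 5)))) ^ 2 := by
      intro x hx
      obtain ⟨hxS, hxd⟩ := hmemF x hx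
      have hxc : dist x c ≤ r / 4 := by
        have := dist_triangle x c₀ c; linarith
      have hxSR : x ∈ SR := hSRball x hxS (by linarith)
      exact pow_le_pow_left₀ (norm_nonneg _) (hforce ⟨x, hxS⟩ hxSR hxc) 2
    calc _ ≤ ∑ x ∈ (finite_sites_dist_le (t := t) (A := A) hA hI c₀ ρ').toFinset,
          (31488 * (1024 / ((23 / 25 : ℝ) ^ 3 * (r / 2) ^ 4)) + 2048 / (δ ^ 3 * (r / 4) ^ 4) +
          (38 * D * (1024 / ((23 / 25 : ℝ) ^ 3 * (r / 4) ^ 5)) + 38 * D * (1024 / ((23 / 25 : ℝ) ^ 3 * (r / 2) ^ 5)))) ^ 2 :=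
          Finset.sum_le_sum hpt
      _ = (finite_sites_dist_le (t := t) (A := A) hA hI c₀ ρ').toFinset.card * _ := by rw [Finset.sum_const, nsmul_eq_mul]
      _ ≤ 32 * ρ' ^ 3 * _ := mul_le_mul_of_nonneg_right (card_ball_sites_le hA hI c₀ hρ' _ hmemF) (sq_nonneg _)
  have hsqrt : Real.sqrt (∑ x ∈ (finite_sites_dist_le (t := t) (A := A) hA hI c₀ ρ').toFinset,
      ‖(fun s : EuclideanSpace ℝ (Fin 3) =>
        (-(∑ s' ∈ SR.erase s, 𝐅[(s - s') + (aff s - aff s')]) -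
          (∑ q ∈ (hX.toFinset.erase (π s)) \ ((SR.erase s).image π),
            (deriv lennardJones (dist (π s) q) / dist (π s) q) • (π s - q)) +
          ((∑ s' ∈ SR.erase s, 𝕂[s - s'] ((1 - χ s') • ((π s' - s') - aff s'))) +
            ∑' q : ↑((SR.subtype (· ∈ Sites₀ t A) : Set (Sites₀ t A)))ᶜ,
              (if s ≠ (q : EuclideanSpace ℝ (Fin 3)) then 𝕂[s - (q : EuclideanSpace ℝ (Fin 3))] ((π s - s) - aff s) else 0)))) x‖ ^ 2) ≤
      Real.sqrt (32 * ρ' ^ 3) * (31488 * (1024 / ((23 / 25 : ℝ) ^ 3 * (r / 2) ^ 4)) + 2048 / (δ ^ 3 * (r / 4) ^ 4) +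
        (38 * D * (1024 / ((23 / 25 : ℝ) ^ 3 * (r / 4) ^ 5)) + 38 * D * (1024 / ((23 / 25 : ℝ) ^ 3 * (r / 2) ^ 5)))) := by
    refine (Real.sqrt_le_sqrt hsumφ).trans (le_of_eq ?_)
    rw [Real.sqrt_mul (by positivity), Real.sqrt_sq hΦ₀]
  -- monotonicity of the energy bound in the forcing sum
  have hρ'0 : 0 ≤ 400 * ρ' / 189 + 2 := by positivity
  gcongr

end

end Summit.AtomisticToContinuum.Crystallization.Theorems.ExcessDecayLiouville

end
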